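import Literature.MathematicalPhysics.QuantumFieldTheory.Balaban1983to89.B15BasicStep
import Literature.MathematicalPhysics.QuantumFieldTheory.Balaban1983to89.B15StandardRep
import Literature.MathematicalPhysics.QuantumFieldTheory.Balaban1983to89.B15Claim179Flow

/-!
# `Balaban1983to89.B15Ineq157Flow` — [Balaban1989LargeFieldI] p. 188, (1.57): the SECOND printed inequality
# *"(L^{j+1}η)^{−1}B₃exp(−δ10M(R_{j+1} + ⋯ + R_{k−1}) − δMR_k)44d²B₃ε_k < 44d²B₃²(1 + β₀)exp(−R_j)ε_j"* PROVED along any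
# renormalization group flow of the [III] setting under ONE located clause `δM ≧ L + 1`; and p. 198, the sentence after
# (1.90), members 2–3 of *"B₃exp(−δ2LM₂R_h)11d²ε_h < 11d²B₃exp(−R_h)ε_h < αε_h"*

statement-level skeleton of published theorems with citation tags; proofs where landed; nothing here is a claim about
the Yang–Mills mass gap.

CITATION HEADER (lean-in-tree rule 2026-08-18).  T. Bałaban, *Large field renormalization. I. The basic step of the 𝐑
operation*, Commun. Math. Phys. **122**, 175–202 (1989), doi:10.1007/BF01257412, bib `Balaban1989LargeFieldI` (cell
paper B15; PDF held `paper:balaban1989-cmp122-large-field-i`, journal page = PDF page + 174; p. 188 and p. 198 READ AS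
IMAGES on the x2 renders `run/shared/lean/pub/pub-balaban/b2b-balaban-ref1/pages/1989-cmp122-large-field-I/…-p014-x2.png`,
`…-p024-x2.png`).  [III] = [Balaban1988Convergent] (cell paper B14): (2.5) p. 255 = `B14.IsRj` (*"R_j is the smallest
number of the form L^r such, that R_j ≧ (log g_j⁻²)^r"*), (2.8) p. 256 first member = `B14FlowStep.flowIneq28a_signfree`
(`ε_n ≦ (1+β₀)(n−m)^{1/2}ε_m` along a flow, `ε_j = g_jA₀(log g_j⁻²)^{p₀}` = `Setup.epsK`), the flow setting of
`B14FlowStep` (`Flow`, `SatisfiesRG` = (I.0.20), `InInterval`, `SmallnessFor`).  WHAT IS REPRODUCED: SKELETON rows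
`B15.Eq1.57` (its second member — the first member is the [14]/[15] decay input and stays the leaf's hypothesis) and
`B15.Eq1.90` (members 2–3 of the ℍ_{h,□}-chain), unit `lit-balaban-r12` gen 8 (reader/typer and fold owner of block B15,
Phase 2 in own block), HOME `run/shared/lean/pub/lit-balaban/` (`lit-balaban-r12/ROWS-B15.md`).  Used BY NAME: the typed
leaf `B15.BasicStep.Ineq157` (both printed members as a conjunction), `B15StandardRep.BoundH190` ((1.90) first member),
`B15Claim179Flow.exp_le_succ` (unit steps of the sizes along a flow), `B14FlowStep.flowIneq28a_signfree`,
`B14FlowStep.log_inv_sq_mono` ∕ `log_inv_sq_nonneg`.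

THE PRINTED TEXT (p. 188, verbatim): *"The field in the argument of the function ℍ^{(n+1)}_{k,Z} has a support in the
boundary layer of the width 2M₁ at the boundary of Z, and is bounded by 44d²B₃ε_k. Thus the function considered on the
domain Ω^c_{j+1}∖Z″_{j+1} satisfies the bound |ℍ^{(n+1)}_{k,Z}| ≦ (L^{j+1}η)^{−1}B₃exp(−δ10M(R_{j+1} + ⋯ + R_{k−1}) − δMR_k)
44d²B₃ε_k < 44d²B₃²(1 + β₀)exp(−R_j)ε_j. (1.57)"*; (p. 198) *"The function ℍ_{h,□} and it[s] derivatives can be bounded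
on □^∼ by B₃exp(−δ2LM₂R_h)11d²ε_h < 11d²B₃exp(−R_h)ε_h < αε_h, where α is a small, absolute constant, which will be fixed
later."*

WHAT IS PROVED (0 `sorry`, no `def`, no new `Prop`).  With `η = L^{−k}` one has `(L^{j+1}η)^{−1} = L^{k−j−1}`
(`inv_Lpow_eta`).  The second member of (1.57) amounts, after `ε_k ≦ (1+β₀)(k−j)^{1/2}ε_j` ((2.8) [III]), to the exponent
comparison `(k−j−1)log L + ½log(k−j) + R_j < δ10M(R_{j+1} + ⋯ + R_{k−1}) + δMR_k` (`exponent157_lt`), which holds for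
ALL `j < k` as soon as `δM ≧ L + 1`, the sizes are `≧ 1` and lose at most one factor `L` per step (`R_l ≦ L·R_{l+1}`,
p. 177 *"in some steps the number R_k decreases by the factor L^{−1}"*; DERIVED along any [III] flow in
`B15Claim179Flow.exp_le_succ`): for `k = j+1` the sum is empty and `δMR_k ≧ (L+1)R_{j+1} ≧ R_j + 1`; for `k ≧ j+2`,
`δ10MR_{j+1} ≧ 10R_j + 10`, every further `R_l ≧ 1`, `log L ≦ L − 1`, `log(k−j) ≦ k−j−1`.  Hence `ineq157_second`
(abstract sizes), **`ineq157_second_along_flow`** (sizes `R_l = L^{s_l}` of (2.5) and `ε_j = epsK A₀ p₀ F j` along a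
flow solving (I.0.20) in `]0, γ]` with `0 ≦ β ≦ β′`, `SmallnessFor` for both exponents), and the typed leaf from its first
member: `ineq157_of_first`.  (1.90): `boundH190_lt` (member 2 under `2δLM₂ > 1`, `R_h > 0`), `boundH190_lt_alpha`
(member 3 under the smallness `11d²B₃e^{−R_h} < α`), `exp_neg_R_le_of_isRj` (why small `γ` gives it: `R_h ≧ (log γ⁻²)^r`).
LOCATED CLAUSE (not printed as such): `δM ≧ L + 1` — what *"M sufficiently large"* (pp. 186, 200; [III]) has to supply
for the second member of (1.57) uniformly in `j < k`; with `δM ≦ L` and two consecutive `L`-steps of the sizes the strict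
inequality can fail at `k = j + 1` (no GAPS entry: a smallness-of-constants clause in the papers' own order «L, then M
large»).  The sign `β ≧ 0` along the flow is the cell's standing unprinted input (`B14FlowStep`).  Real bookkeeping only;
value = the row's printed chain kernel-checked with its constants; NOT summit progress.
-/

namespace Literature.MathematicalPhysics.QuantumFieldTheory.Balaban1983to89.B15Ineq157Flow

open Literature.MathematicalPhysics.QuantumFieldTheory.Balaban1983to89
open B15.BasicStep B15StandardRep B15Claim179Flow B14FlowStep

/-! ## §1. The exponent comparison behind the second member of (1.57) -/

/-- `(L^{j+1}η)^{−1} = L^{k−j−1}` for `η = L^{−k}`, `j + 1 ≦ k`, `L ≠ 0` (the prefactor of (1.57) in the units of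
[III] §2, `T_η`, `η = L^{−k}`). [cite: Balaban1989LargeFieldI, (1.57) p.188] -/
theorem inv_Lpow_eta {L η : ℝ} (hL : L ≠ 0) {j k : ℕ} (hjk : j + 1 ≤ k) (hη : η = (L ^ k)⁻¹) :
    (L ^ (j + 1) * η)⁻¹ = L ^ (k - j - 1) := by
  rw [hη]
  obtain ⟨t, rfl⟩ : ∃ t, k = j + 1 + t := ⟨k - (j + 1), by omega⟩
  have h1 : L ^ (j + 1) ≠ 0 := pow_ne_zero _ hL
  rw [show j + 1 + t - j - 1 = t by omega, mul_inv, inv_inv, pow_add L (j + 1) t, inv_mul_cancel_left₀ h1]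

/-- **The exponent comparison** (p. 188, what the `<` of (1.57) needs): for sizes `R_l ≧ 1` losing at most one factor `L`
per step (`R_l ≦ L·R_{l+1}` for `j ≦ l < k`), `L ≧ 2` and `D = δM ≧ L + 1`:
`(k−j−1)log L + ½log(k−j) + R_j < 10D(R_{j+1} + ⋯ + R_{k−1}) + DR_k` for every `j < k`. [cite: Balaban1989LargeFieldI, (1.57) p.188] -/
theorem exponent157_lt {L D : ℝ} {R : ℕ → ℝ} {j k : ℕ} (hjk : j < k) (hL : 2 ≤ L) (hD : L + 1 ≤ D)
    (hR1 : ∀ l, 1 ≤ R l) (hstep : ∀ l, j ≤ l → l < k → R l ≤ L * R (l + 1)) :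
    ((k : ℝ) - j - 1) * Real.log L + 1 / 2 * Real.log ((k : ℝ) - j) + R j
      < 10 * D * (∑ l ∈ Finset.Ico (j + 1) k, R l) + D * R k := by
  have hL0 : (0 : ℝ) < L := by linarith
  have hlogL : Real.log L ≤ D := by
    have := Real.log_le_sub_one_of_pos hL0
    linarith
  have hlogL0 : 0 ≤ Real.log L := Real.log_nonneg (by linarith)
  have hkj : (1 : ℝ) ≤ (k : ℝ) - j := by
    have : j + 1 ≤ k := hjk
    have : ((j : ℝ) + 1) ≤ k := by exact_mod_cast this
    linarith
  have hlogkj : Real.log ((k : ℝ) - j) ≤ (k : ℝ) - j - 1 := Real.log_le_sub_one_of_pos (by linarith)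
  have hRj1 := hR1 (j + 1)
  have hstepj : R j ≤ L * R (j + 1) := hstep j le_rfl hjk
  have hDRj : R j + R (j + 1) ≤ D * R (j + 1) := by nlinarith
  -- LHS ≤ t·D + t/2 + R_j with t = k − j − 1
  have hLHS : ((k : ℝ) - j - 1) * Real.log L + 1 / 2 * Real.log ((k : ℝ) - j) + R j
      ≤ ((k : ℝ) - j - 1) * D + 1 / 2 * ((k : ℝ) - j - 1) + R j := by
    have h1 : ((k : ℝ) - j - 1) * Real.log L ≤ ((k : ℝ) - j - 1) * D :=
      mul_le_mul_of_nonneg_left hlogL (by linarith)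
    linarith
  rcases Nat.lt_or_ge k (j + 2) with hk | hk
  · -- k = j + 1: empty sum
    have hk1 : k = j + 1 := by omega
    subst hk1
    have e1 : (((j + 1 : ℕ) : ℝ) - j - 1) = 0 := by push_cast; ring
    have e2 : (((j + 1 : ℕ) : ℝ) - j) = 1 := by push_cast; ring
    rw [e1, e2, Real.log_one]
    simp only [Finset.Ico_self, Finset.sum_empty, mul_zero, zero_mul, zero_add]
    linarith
  · -- k ≥ j + 2
    rw [Finset.sum_eq_sum_Ico_succ_bot (by omega : j + 1 < k)]
    have hrest : (((k - (j + 2) : ℕ) : ℝ)) * 1 ≤ ∑ l ∈ Finset.Ico (j + 1 + 1) k, R l := by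
      have := Finset.sum_le_sum (s := Finset.Ico (j + 2) k) (f := fun _ => (1 : ℝ)) (g := R)
        (fun l _ => hR1 l)
      rw [Finset.sum_const, Nat.card_Ico, nsmul_eq_mul] at this
      exact this
    have hcast : (((k - (j + 2) : ℕ) : ℝ)) = (k : ℝ) - j - 2 := by
      rw [Nat.cast_sub hk]; push_cast; ring
    rw [hcast] at hrest
    have hD3 : (3 : ℝ) ≤ D := by linarith
    have ht1 : (1 : ℝ) ≤ (k : ℝ) - j - 1 := by
      have : ((j : ℝ) + 2) ≤ k := by exact_mod_cast hk
      linarith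
    have hprod : 0 ≤ (D - 3) * ((k : ℝ) - j - 1 - 1) := mul_nonneg (by linarith) (by linarith)
    have hRk := hR1 k
    have hsum0 : 0 ≤ ∑ l ∈ Finset.Ico (j + 1 + 1) k, R l := by linarith
    nlinarith

/-- **(1.57), second member, for abstract sizes** — p. 188: with `Lpow = (L^{j+1}η)^{−1} = L^{k−j−1}`,
`sumR = R_{j+1} + ⋯ + R_{k−1}`, the (2.8) [III] input `ε_k ≦ (1+β₀)(k−j)^{1/2}ε_j`, sizes `R_l ≧ 1` with `R_l ≦ L·R_{l+1}`,
`L ≧ 2`, the located clause `δM ≧ L + 1`, and signs `ε_j > 0`, `β₀ ≧ 0`, `B₃ > 0`, `d > 0`: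
`L^{k−j−1}B₃exp(−δ10M·sumR − δMR_k)44d²B₃ε_k < 44d²B₃²(1 + β₀)exp(−R_j)ε_j`. [cite: Balaban1989LargeFieldI, (1.57) p.188] -/
theorem ineq157_second {L δ M B₃ d εk εj β₀ : ℝ} {R : ℕ → ℝ} {j k : ℕ} (hjk : j < k) (hL : 2 ≤ L)
    (hδM : L + 1 ≤ δ * M) (hR1 : ∀ l, 1 ≤ R l) (hstep : ∀ l, j ≤ l → l < k → R l ≤ L * R (l + 1))
    (hεk : εk ≤ (1 + β₀) * Real.sqrt ((k : ℝ) - j) * εj) (hεj : 0 < εj) (hβ₀ : 0 ≤ β₀) (hB₃ : 0 < B₃)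
    (hd : 0 < d) :
    L ^ (k - j - 1) * B₃ * Real.exp (-(δ * 10 * M * ∑ l ∈ Finset.Ico (j + 1) k, R l) - δ * M * R k)
        * (44 * d ^ 2) * B₃ * εk
      < 44 * d ^ 2 * B₃ ^ 2 * (1 + β₀) * Real.exp (-R j) * εj := by
  have hL0 : (0 : ℝ) < L := by linarith
  have hkj0 : (0 : ℝ) < (k : ℝ) - j := by
    have : ((j : ℝ) + 1) ≤ k := by exact_mod_cast hjk
    linarith
  set E := δ * 10 * M * ∑ l ∈ Finset.Ico (j + 1) k, R l + δ * M * R k with hEdef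
  have hE : Real.exp (-(δ * 10 * M * ∑ l ∈ Finset.Ico (j + 1) k, R l) - δ * M * R k) = Real.exp (-E) := by
    congr 1; rw [hEdef]; ring
  rw [hE]
  -- the key comparison `L^{k−j−1}·√(k−j)·e^{−E} < e^{−R_j}`
  have hexp := exponent157_lt (D := δ * M) hjk hL hδM hR1 hstep
  have hkey : L ^ (k - j - 1) * Real.sqrt ((k : ℝ) - j) * Real.exp (-E) < Real.exp (-R j) := by
    have e1 : L ^ (k - j - 1) = Real.exp (((k - j - 1 : ℕ) : ℝ) * Real.log L) := by
      rw [Real.exp_nat_mul, Real.exp_log hL0]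
    have e2 : Real.sqrt ((k : ℝ) - j) = Real.exp (Real.log ((k : ℝ) - j) * (1 / 2)) := by
      rw [Real.sqrt_eq_rpow, Real.rpow_def_of_pos hkj0]
    have hcast : (((k - j - 1 : ℕ) : ℝ)) = (k : ℝ) - j - 1 := by
      rw [Nat.sub_sub, Nat.cast_sub (by omega : j + 1 ≤ k)]; push_cast; ring
    rw [e1, e2, ← Real.exp_add, ← Real.exp_add, Real.exp_lt_exp, hcast]
    linarith [hexp, hEdef]
  -- assemble
  have hC : 0 < 44 * d ^ 2 * B₃ ^ 2 * (1 + β₀) * εj := by positivity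
  have hpre : 0 ≤ L ^ (k - j - 1) * B₃ * Real.exp (-E) * (44 * d ^ 2) * B₃ := by positivity
  calc L ^ (k - j - 1) * B₃ * Real.exp (-E) * (44 * d ^ 2) * B₃ * εk
      ≤ L ^ (k - j - 1) * B₃ * Real.exp (-E) * (44 * d ^ 2) * B₃ * ((1 + β₀) * Real.sqrt ((k : ℝ) - j) * εj) :=
        mul_le_mul_of_nonneg_left hεk hpre
    _ = (L ^ (k - j - 1) * Real.sqrt ((k : ℝ) - j) * Real.exp (-E)) * (44 * d ^ 2 * B₃ ^ 2 * (1 + β₀) * εj) := by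
        ring
    _ < Real.exp (-R j) * (44 * d ^ 2 * B₃ ^ 2 * (1 + β₀) * εj) := mul_lt_mul_of_pos_right hkey hC
    _ = 44 * d ^ 2 * B₃ ^ 2 * (1 + β₀) * Real.exp (-R j) * εj := by ring

/-- **The typed leaf (1.57) from its first member**: `B15.BasicStep.Ineq157 H Lpow B₃ δ M sumR Rk Rj d εk εj β₀` is the
conjunction «`H ≦` first expression» ∧ «first expression `<` second»; under the hypotheses of `ineq157_second` the second
conjunct holds, so the leaf follows from the [14]/[15] input `H ≦ L^{k−j−1}B₃exp(⋯)44d²B₃ε_k` alone (`Lpow = L^{k−j−1}`,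
`sumR = R_{j+1} + ⋯ + R_{k−1}`, `Rk = R_k`, `Rj = R_j`). [cite: Balaban1989LargeFieldI, (1.57) p.188] -/
theorem ineq157_of_first {H L δ M B₃ d εk εj β₀ : ℝ} {R : ℕ → ℝ} {j k : ℕ} (hjk : j < k) (hL : 2 ≤ L)
    (hδM : L + 1 ≤ δ * M) (hR1 : ∀ l, 1 ≤ R l) (hstep : ∀ l, j ≤ l → l < k → R l ≤ L * R (l + 1))
    (hεk : εk ≤ (1 + β₀) * Real.sqrt ((k : ℝ) - j) * εj) (hεj : 0 < εj) (hβ₀ : 0 ≤ β₀) (hB₃ : 0 < B₃)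
    (hd : 0 < d)
    (hH : H ≤ L ^ (k - j - 1) * B₃ * Real.exp (-(δ * 10 * M * ∑ l ∈ Finset.Ico (j + 1) k, R l) - δ * M * R k)
        * (44 * d ^ 2) * B₃ * εk) :
    Ineq157 H (L ^ (k - j - 1)) B₃ δ M (∑ l ∈ Finset.Ico (j + 1) k, R l) (R k) (R j) d εk εj β₀ :=
  ⟨hH, ineq157_second hjk hL hδM hR1 hstep hεk hεj hβ₀ hB₃ hd⟩

/-! ## §2. Along a renormalization group flow of the [III] setting -/

section AlongFlow

variable (F : Flow) (K : ℕ) {γ β' β₀ : ℝ} {L r p₀ : ℕ}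

/-- `ε_j = g_j·A₀(log g_j⁻²)^{p₀} > 0` along the flow (`0 < g_j ≦ γ < 1`, `A₀ > 0`). [cite: Balaban1988Convergent, (2.4) p.255] -/
theorem epsK_pos_of_inInterval {A₀ : ℝ} (hA₀ : 0 < A₀) (hγ : γ < 1) (hI : F.InInterval γ K) {j : ℕ} (hj : j ≤ K) :
    0 < epsK A₀ p₀ F j := by
  obtain ⟨hg0, hgγ⟩ := hI j hj
  unfold epsK p0Profile
  have hlog : 0 < Real.log ((F.g j) ^ 2)⁻¹ := by
    apply Real.log_pos
    have h1 : (F.g j) ^ 2 < 1 := by nlinarith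
    exact one_lt_inv₀ (by positivity) |>.mpr h1
  positivity

/-- **(1.57), second member, ALONG ANY RENORMALIZATION GROUP FLOW of the [III] setting**: (I.0.20) up to `K`,
`0 < g_j ≦ γ`, `0 ≦ β_{j+1}(g_j) ≦ β′`, `SmallnessFor γ β′ β₀ L r` and `SmallnessFor γ β′ β₀ L p₀` (the exponents of (2.5)
and of (2.4)), sizes `R_l = L^{s_l}` as in (2.5), `ε_j = epsK A₀ p₀ F j` (`A₀ > 0`), for all `j < k ≦ K`, under the located
clause `δM ≧ L + 1` (`B₃, d > 0`): `L^{k−j−1}B₃exp(−δ10M(R_{j+1} + ⋯ + R_{k−1}) − δMR_k)44d²B₃ε_k <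
44d²B₃²(1 + β₀)exp(−R_j)ε_j` — the (2.8) input is `B14FlowStep.flowIneq28a_signfree`, the unit steps are
`B15Claim179Flow.exp_le_succ`. [cite: Balaban1989LargeFieldI, (1.57) p.188] -/
theorem ineq157_second_along_flow (Sr : SmallnessFor γ β' β₀ L r) (Sp : SmallnessFor γ β' β₀ L p₀)
    (hrg : F.SatisfiesRG K) (hI : F.InInterval γ K) (hub : ∀ j, j < K → F.β (j + 1) (F.g j) ≤ β')
    (hlb : ∀ j, j < K → 0 ≤ F.β (j + 1) (F.g j)) {s : ℕ → ℕ}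
    (hs : ∀ j, j ≤ K → B14.IsRj L r (F.g j) (L ^ s j)) {A₀ : ℝ} (hA₀ : 0 < A₀)
    {j k : ℕ} (hjk : j < k) (hkK : k ≤ K) {δ M B₃ d : ℝ} (hδM : (L : ℝ) + 1 ≤ δ * M) (hB₃ : 0 < B₃)
    (hd : 0 < d) :
    (L : ℝ) ^ (k - j - 1) * B₃
        * Real.exp (-(δ * 10 * M * ∑ l ∈ Finset.Ico (j + 1) k, (L : ℝ) ^ s l) - δ * M * (L : ℝ) ^ s k)
        * (44 * d ^ 2) * B₃ * epsK A₀ p₀ F k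
      < 44 * d ^ 2 * B₃ ^ 2 * (1 + β₀) * Real.exp (-(L : ℝ) ^ s j) * epsK A₀ p₀ F j := by
  have hL2 : (2 : ℝ) ≤ L := by exact_mod_cast Sr.hL
  have hL1 : (1 : ℝ) ≤ L := by linarith
  have hR1 : ∀ l, (1 : ℝ) ≤ (L : ℝ) ^ s l := fun l => one_le_pow₀ hL1
  have hstep : ∀ l, j ≤ l → l < k → (L : ℝ) ^ s l ≤ (L : ℝ) * (L : ℝ) ^ s (l + 1) := by
    intro l _ hlk
    have h1 := exp_le_succ F K Sr hrg hI hub hlb hs (by omega : l + 1 ≤ K)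
    calc (L : ℝ) ^ s l ≤ (L : ℝ) ^ (s (l + 1) + 1) := pow_le_pow_right₀ hL1 h1
      _ = (L : ℝ) * (L : ℝ) ^ s (l + 1) := by rw [pow_succ]; ring
  have hεk := flowIneq28a_signfree F K Sp hA₀.le hrg hI hub hjk hkK
  have hεj := epsK_pos_of_inInterval F K (p₀ := p₀) hA₀ Sp.γ_lt_one hI (hjk.le.trans hkK)
  exact ineq157_second (R := fun l => (L : ℝ) ^ s l) hjk hL2 hδM hR1 hstep hεk hεj Sr.β₀_pos.le hB₃ hd

/-- … and the typed leaf `B15.BasicStep.Ineq157` along the flow from its first member (the [14]/[15] input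
`|ℍ^{(n+1)}_{k,Z}| ≦ (L^{j+1}η)^{−1}B₃exp(⋯)44d²B₃ε_k`, hypothesis `hH`). [cite: Balaban1989LargeFieldI, (1.57) p.188] -/
theorem ineq157_along_flow (Sr : SmallnessFor γ β' β₀ L r) (Sp : SmallnessFor γ β' β₀ L p₀)
    (hrg : F.SatisfiesRG K) (hI : F.InInterval γ K) (hub : ∀ j, j < K → F.β (j + 1) (F.g j) ≤ β')
    (hlb : ∀ j, j < K → 0 ≤ F.β (j + 1) (F.g j)) {s : ℕ → ℕ}
    (hs : ∀ j, j ≤ K → B14.IsRj L r (F.g j) (L ^ s j)) {A₀ : ℝ} (hA₀ : 0 < A₀)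
    {j k : ℕ} (hjk : j < k) (hkK : k ≤ K) {δ M B₃ d H : ℝ} (hδM : (L : ℝ) + 1 ≤ δ * M) (hB₃ : 0 < B₃)
    (hd : 0 < d)
    (hH : H ≤ (L : ℝ) ^ (k - j - 1) * B₃
        * Real.exp (-(δ * 10 * M * ∑ l ∈ Finset.Ico (j + 1) k, (L : ℝ) ^ s l) - δ * M * (L : ℝ) ^ s k)
        * (44 * d ^ 2) * B₃ * epsK A₀ p₀ F k) :
    Ineq157 H ((L : ℝ) ^ (k - j - 1)) B₃ δ M (∑ l ∈ Finset.Ico (j + 1) k, (L : ℝ) ^ s l) ((L : ℝ) ^ s k)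
      ((L : ℝ) ^ s j) d (epsK A₀ p₀ F k) (epsK A₀ p₀ F j) β₀ :=
  ⟨hH, ineq157_second_along_flow F K Sr Sp hrg hI hub hlb hs hA₀ hjk hkK hδM hB₃ hd⟩

end AlongFlow

/-! ## §3. (1.90), the sentence after it: members 2–3 of the `ℍ_{h,□}`-chain -/

/-- **(1.90), member 2** (p. 198): from the first member `sH ≦ B₃exp(−δ2LM₂R_h)11d²ε_h` (`B15StandardRep.BoundH190`),
`2δLM₂ > 1`, `R_h > 0`, `B₃, d, ε_h > 0`: `sH < 11d²B₃exp(−R_h)ε_h`. [cite: Balaban1989LargeFieldI, (1.90) p.198] -/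
theorem boundH190_lt {sH B₃ δ L M₂ Rh d εh : ℝ} (h : BoundH190 sH B₃ δ L M₂ Rh d εh)
    (hc : 1 < δ * 2 * L * M₂) (hRh : 0 < Rh) (hB₃ : 0 < B₃) (hd : 0 < d) (hε : 0 < εh) :
    sH < 11 * d ^ 2 * B₃ * Real.exp (-Rh) * εh := by
  unfold BoundH190 at h
  have hexp : Real.exp (-(δ * 2 * L * M₂ * Rh)) < Real.exp (-Rh) := by
    rw [Real.exp_lt_exp]
    have : 1 * Rh < δ * 2 * L * M₂ * Rh := mul_lt_mul_of_pos_right hc hRh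
    linarith
  have hpos : 0 < B₃ * (11 * d ^ 2) * εh := by positivity
  calc sH ≤ B₃ * Real.exp (-(δ * 2 * L * M₂ * Rh)) * (11 * d ^ 2) * εh := h
    _ = Real.exp (-(δ * 2 * L * M₂ * Rh)) * (B₃ * (11 * d ^ 2) * εh) := by ring
    _ < Real.exp (-Rh) * (B₃ * (11 * d ^ 2) * εh) := mul_lt_mul_of_pos_right hexp hpos
    _ = 11 * d ^ 2 * B₃ * Real.exp (-Rh) * εh := by ring

/-- **(1.90), member 3** (p. 198): *"< αε_h, where α is a small, absolute constant"* — under the smallness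
`11d²B₃exp(−R_h) < α` (and the hypotheses of `boundH190_lt`): `sH < αε_h`. [cite: Balaban1989LargeFieldI, (1.90) p.198] -/
theorem boundH190_lt_alpha {sH B₃ δ L M₂ Rh d εh α : ℝ} (h : BoundH190 sH B₃ δ L M₂ Rh d εh)
    (hc : 1 < δ * 2 * L * M₂) (hRh : 0 < Rh) (hB₃ : 0 < B₃) (hd : 0 < d) (hε : 0 < εh)
    (hα : 11 * d ^ 2 * B₃ * Real.exp (-Rh) < α) : sH < α * εh := by
  have h1 := boundH190_lt h hc hRh hB₃ hd hε
  have h2 : 11 * d ^ 2 * B₃ * Real.exp (-Rh) * εh < α * εh := mul_lt_mul_of_pos_right hα hε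
  linarith

/-- Why small `γ` delivers the smallness of member 3 (and *"smaller than any positive power of g_j"*, p. 188): by (2.5)
[III] `R ≧ (log g⁻²)^r ≧ (log γ⁻²)^r` for `0 < g ≦ γ ≦ 1`, so `exp(−R) ≦ exp(−(log γ⁻²)^r)`. [cite: Balaban1989LargeFieldI, (1.90) p.198] -/
theorem exp_neg_R_le_of_isRj {L r : ℕ} {g γ : ℝ} {R : ℕ} (h : B14.IsRj L r g R) (hg : 0 < g) (hgγ : g ≤ γ)
    (hγ1 : γ ≤ 1) : Real.exp (-(R : ℝ)) ≤ Real.exp (-(Real.log (γ ^ 2)⁻¹) ^ r) := by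
  obtain ⟨_, _, hle, _⟩ := h
  have hmono : Real.log (γ ^ 2)⁻¹ ≤ Real.log (g ^ 2)⁻¹ := log_inv_sq_mono hg hgγ
  have h0 : 0 ≤ Real.log (γ ^ 2)⁻¹ := log_inv_sq_nonneg (lt_of_lt_of_le hg hgγ) hγ1
  have hpow : (Real.log (γ ^ 2)⁻¹) ^ r ≤ (Real.log (g ^ 2)⁻¹) ^ r := pow_le_pow_left₀ h0 hmono r
  rw [Real.exp_le_exp]
  linarith [hpow.trans hle]

end Literature.MathematicalPhysics.QuantumFieldTheory.Balaban1983to89.B15Ineq157Flow
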